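import Mathlib
import Literature.Analysis.Complex.LogOnePlus
import Literature.Analysis.Matrix.DetExp

/-!
# Dimock, *The renormalization group according to Balaban* II (large fields), §3.8 "fluctuation integral": the LOCAL
# SQUARE ROOT `(C^{1/2}_{k,Ω′})^{loc}` of the fluctuation covariance — the quadratic form `R^{(4)}`, the DETERMINANT
# IDENTITY `det((C^{1/2})^{loc}) = det(C^{1/2}) exp(R^{(5)})`, `R^{(5)} = −Σ_{n≥1}(1/n) tr((C^{−1/2}δC^{1/2})ⁿ)` (eq. (onionstew),
# *"For the last identity see (2.41) in [Bal98a]"*), §3.9 Lemma 3.7 (`r5`: the local expansion `R^{(5)} = Σ_□ R^{(5)}(□)`,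
# `|R^{(5)}(□)| ≤ C(LM)³e^{−r_{k+1}}`) and Lemma 3.6 (`stem`) part 2 (the Neumann inversion of `(C^{1/2})^{loc}`) — PROVED
# as finite-dimensional operator calculus in the sup-norm (`ℓ^∞`-operator) norm

**Citation header (reproduction of PUBLISHED work; template of the Bałaban lattice Yang–Mills cell).**
J. Dimock, *The renormalization group according to Balaban II. Large fields*, J. Math. Phys. **54** (2013) 092301
(= arXiv:1212.5562v2) [Dimock2013BalabanII], §3.8 `\subsection{fluctuation integral} \label{bingo}` (TeX L3114–3347) and
§3.9 `\subsection{estimates}` (L3349–3598): Lemma 3.6 `\label{stem}` L3431–3512, Lemma 3.7 `\label{r5}` L3516–3540.  TeX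
line numbers refer to the arXiv source held by the cell on this hub at
`run/shared/lean/archive/nearmiss/qft-balaban/dimock/src/1212.5562/1212.5562.tex` (7217 lines, sha256[:16]
75c5792fc48eacbc); every quotation below was read there this session.  Dimock's papers are published and refereed and
are the cell's TEMPLATE, not manuscripts under audit; no quantity of the Bałaban series is touched.  The by-reference
target of this file: Dimock cites the determinant identity to Bałaban's N-vector paper [Bal98a] = T. Bałaban, *A low
temperature expansion for classical N-vector models III*, Commun. Math. Phys. **196** (1998) 485–521, eq. (2.41) — NOT
held by the cell; the identity is proved here from first principles (it is standard Banach-algebra calculus), so nothing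
of [Bal98a] is asserted or needed.

**What the paper prints (verbatim).**  L3186–3209: *"We will also see that (C^{1/2}_{k,Ω′})^{loc} is invertible, and we
make the change of variables Z = (C^{1/2}_{k,Ω′})^{loc}W_k where W_k : Ω^{(k)}_{k+1} → ℝ.  The quadratic form
½⟨Z, C^{−1}_{k,Ω′}Z⟩ becomes ½⟨(C^{1/2}_{k,Ω′})^{loc}W_k, C^{−1}_{k,Ω′}(C^{1/2}_{k,Ω′})^{loc}W_k⟩ = ½‖W_k‖²_{Ω_{k+1}} −
R^{(4)}_{Π,Ω_{k+1}} where R^{(4)}_{Π,Ω_{k+1}} = ⟨C^{−1/2}_{k,Ω′}W_k, δC^{1/2}_{k,Ω′}W_k⟩ − ½⟨δC^{1/2}_{k,Ω′}W_k,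
C^{−1}_{k,Ω′}δC^{1/2}_{k,Ω′}W_k⟩ is tiny.  The change of variables also introduces det((C^{1/2}_{k,Ω′})^{loc}) =
det C^{1/2}_{k,Ω′} exp(R^{(5)}_{Π,Ω_{k+1}}) where"* (onionstew) L3211–3217 *"R^{(5)}_{Π,Ω_{k+1}} = tr log((C^{1/2}_{k,Ω′})^{loc})
− tr log(C^{1/2}_{k,Ω′}) = −Σ_{n=1}^∞ (1/n) tr((C^{−1/2}_{k,Ω′} δC^{1/2}_{k,Ω′})ⁿ)"*, L3218: *"For the last identity see
(2.41) in [Bal98a].  This is also tiny."*  Here (L3182–3186) *"δC^{1/2}_{k,Ω′} = C^{1/2}_{k,Ω′} − (C^{1/2}_{k,Ω′})^{loc}"*.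
Lemma `stem` (2.) L3440–3445: *"C^{1/2}_{k,Ω′} and (C^{1/2}_{k,Ω′})^{loc} are invertible and |C^{−1/2}_{k,Ω′}f|,
|[(C^{1/2}_{k,Ω′})^{loc}]^{−1}f| ≤ C‖f‖_∞"*, proof L3506–3512: *"Finally we write (C^{1/2}_{k,Ω′})^{loc} = C^{1/2}_{k,Ω′} −
δC^{1/2}_{k,Ω′} and then the inverse is realized as [(C^{1/2}_{k,Ω′})^{loc}]^{−1} = C^{−1/2}_{k,Ω′} Σ_{n=0}^∞
(δC^{1/2}_{k,Ω′} C^{−1/2}_{k,Ω′})ⁿ  The convergence and the bound then follow from |C^{−1/2}_{k,Ω′}f| ≤ C‖f‖_∞ and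
|δC^{1/2}_{k,Ω′}f| ≤ e^{−r_{k+1}}‖f‖_∞, since we can assume Ce^{−r_{k+1}} < ½."*  Lemma `r5` L3516–3521:
*"R^{(5)}_{Π,Ω_{k+1}} has a local expansion in LM cubes R^{(5)}_{Π,Ω_{k+1}} = Σ_{□⊂Ω_{k+1}} R^{(5)}_{Π,Ω_{k+1}}(□),
|R^{(5)}_{Π,Ω_{k+1}}(□)| ≤ C(LM)³e^{−½r_{k+1}}"*, proof (spiffy) L3527–3540: *"R^{(5)}_{Π,Ω_{k+1}}(□) = −Σ_{n=1}^∞ (1/n)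
tr(1_□(C^{−1/2}δC^{1/2})ⁿ) = −Σ_{n=1}^∞ (1/n) Σ_{y∈□}(((C^{−1/2}δC^{1/2})ⁿ)δ_y)(y) … |(((C^{−1/2}δC^{1/2})ⁿ)δ_y)(y)| ≤
(Ce^{−r_{k+1}})ⁿ‖δ_y‖_∞ ≤ (Ce^{−r_{k+1}})ⁿ  Summing over y ∈ □ gives the factor (LM)³ and summing over n gives the
result."*

**What is reproduced here (kernel-checked, zero `sorry`).**  Finite-dimensional matrix calculus on an abstract finite
index type `m` (print: the unit lattice `Ω^{(k)}_{k+1}`), with `S` an invertible matrix standing for `C^{1/2}_{k,Ω′}`,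
`δ` for `δC^{1/2}_{k,Ω′}`, `S − δ` for `(C^{1/2}_{k,Ω′})^{loc}`, `J = S⁻¹δ` for `C^{−1/2}δC^{1/2}`; all operator norms
are Mathlib's `ℓ^∞`-OPERATOR NORM (scope `Matrix.Norms.Operator`: `‖A‖ = max_i Σ_j |A_{ij}|`), which IS the sup-norm
operator bound `sup_{‖f‖_∞≤1}‖Af‖_∞` in which Dimock states every smallness here (`Matrix.linfty_opNorm_mulVec`,
`opNorm_le_of_mulVec_le`).
* §1 `R^{(4)}`: **`quadForm_loc`** ∕ `quadForm_loc_half` — for a real symmetric invertible `S` and any `δ`, `W`: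
  `⟨(S − δ)W, (SS)⁻¹(S − δ)W⟩ = ‖W‖² − 2⟨S⁻¹W, δW⟩ + ⟨δW, (SS)⁻¹δW⟩`, i.e. `½⟨Z, C⁻¹Z⟩ = ½‖W‖² − R^{(4)}` with the
  printed `R^{(4)}` (`C = S²`, `C^{−1/2} = S⁻¹`).
* §2 the series in any complete normed `ℂ`-algebra: **`hasSum_logOnePlus_neg`** (`log(1 − J) = −Σ_{n≥1}(1/n)Jⁿ` for
  `‖J‖ < 1`, the tree's `Literature.Analysis.Complex.logOnePlus` at `−J`), `exp_logOnePlus_neg` (`e^{log(1−J)} = 1 − J`,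
  the tree's `exp_logOnePlus`), `norm_logOnePlus_neg_le` (`‖log(1 − J)‖ ≤ −log(1 − ‖J‖)`), the real majorant
  `hasSum_pow_div` and `neg_log_one_sub_le_two_mul` (`−log(1 − t) ≤ 2t`, `t ≤ ½`).
* §3 (onionstew) for complex matrices: **`hasSum_trace_logOnePlus_neg`** (`tr log(1 − J) = −Σ_{n≥1}(1/n)tr(Jⁿ)`, the trace
  being continuous: `traceCLM`, `norm_trace_le`), **`det_one_sub_eq_cexp_trace`** (`det(1 − J) = e^{tr log(1 − J)}` —
  `exp log = id` in the Banach algebra of matrices and Liouville's formula, the tree's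
  `Literature.Analysis.Matrix.det_exp_eq_exp_trace`), `det_sub_mul_eq_det_mul_cexp`; then, with `R5 S δ := tr log(1 − S⁻¹δ)`:
  **`hasSum_R5`** (the printed series, second equality of (onionstew)), **`det_loc_eq_det_mul_cexp_R5`** (THE IDENTITY
  `det(S − δ) = det S · e^{R^{(5)}}` for every invertible `S` and `‖S⁻¹δ‖ < 1`), `isUnit_det_loc`, and the size
  **`norm_R5_le`** (`|R^{(5)}| ≤ #m·(−log(1 − ‖S⁻¹δ‖))`), `norm_R5_le_two_mul` (`≤ 2#m‖S⁻¹δ‖` for `‖S⁻¹δ‖ ≤ ½`).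
* §4 Lemma `r5`: blocks `block cube b` of any block map `cube : m → B` (print: the `LM`-cubes `□ ⊂ Ω_{k+1}`),
  **`R5loc J cube b`** `:= −Σ'_n (1/n) Σ_{y∈□}(Jⁿ)_{yy}` (= (spiffy): `pow_apply_eq_mulVec_single` is `(Jⁿ)_{yy} = (Jⁿδ_y)(y)`),
  `norm_blockTerm_le`, `hasSum_R5loc`, **`norm_R5loc_le`** (`|R^{(5)}(□)| ≤ #□·(−log(1 − ‖J‖))`), `norm_R5loc_le_two_mul`
  (`≤ 2#□‖J‖` for `‖J‖ ≤ ½` — with `#□ = (LM)³`, `‖J‖ ≤ Ce^{−r_{k+1}}` this is the printed `C(LM)³e^{−r_{k+1}}`-type bound),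
  **`sum_R5loc_eq`** ∕ **`R5_eq_sum_R5loc`** (`R^{(5)} = Σ_□ R^{(5)}(□)`: the trace is the sum of the diagonal over the
  blocks, `Finset.sum_fiberwise`, and the series may be summed blockwise).
* §5 Lemma `stem` (2.): **`inv_loc_eq`** (`(S − δ)⁻¹ = S⁻¹ Σ_{n≥0}(δS⁻¹)ⁿ` for `‖δS⁻¹‖ < 1`, the geometric series
  `mul_neg_geom_series`), `isUnit_det_loc_of_norm_lt`, `loc_mul_inv_series`, **`norm_inv_loc_le`** (`‖S⁻¹‖ ≤ c`, `‖δ‖ ≤ ε`,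
  `cε ≤ ½` ⟹ `‖(S − δ)⁻¹‖ ≤ 2c`), `norm_inv_loc_mulVec_le` (the pointwise sup-norm form `|[(C^{1/2})^{loc}]⁻¹f| ≤ 2c‖f‖_∞`),
  `opNorm_le_of_mulVec_le` (sup-norm operator bounds ⟹ the norm hypotheses).
* §6 REAL matrices (Dimock's operators act on `W_k : Ω^{(k)}_{k+1} → ℝ`): complexification `cplx` preserves the norm
  (`norm_cplx`); `R5real J := Re tr log(1 − J_ℂ)` with `hasSum_R5real` (`= −Σ_{n≥1}(1/n)tr(Jⁿ)` in `ℝ`),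
  `im_trace_logOnePlus_neg_cplx` (the imaginary part vanishes), and **`det_loc_eq_det_mul_rexp`**:
  `det(S − δ) = det S · e^{R^{(5)}}` over `ℝ` for invertible real `S` and `‖S⁻¹δ‖ < 1`.  (v1.1) the REAL-SIDE LOCAL
  EXPANSION: **`R5real_eq_sum_re_R5loc`** (`R^{(5)} = Σ_□ Re R^{(5)}(□)` for real `J`, the block terms the real parts of
  §4's) with the per-cube bounds **`abs_re_R5loc_le`** (`|Re R^{(5)}(□)| ≤ #□·(−log(1 − ‖J‖))`) and
  **`abs_re_R5loc_le_two_mul`** (`≤ 2#□‖J‖` for `‖J‖ ≤ ½`).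
* §7 a non-vacuity `example` (`S = 1`, `δ = ½·1`).

**Readings (declared).**  (i) `R^{(5)}` is taken BY ITS SERIES ∕ as `tr log(C^{−1/2}(C^{1/2})^{loc}) = tr log(1 − J)`
(the quantity the determinant identity and Lemma `r5` use); the printed intermediate form *"tr log((C^{1/2})^{loc}) − tr
log(C^{1/2})"* with two separate logarithms is notational and is not given a separate meaning here (for the positive
self-adjoint `C^{1/2}` a logarithm exists by the spectral theorem, for `(C^{1/2})^{loc}` one is `log C^{1/2} + …` only
formally).  (ii) Smallness is `‖J‖ < 1` in the `ℓ^∞`-operator norm — implied by, and for Dimock equal to, his sup-norm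
bounds `|C^{−1/2}f| ≤ C‖f‖_∞`, `|δC^{1/2}f| ≤ e^{−r_{k+1}}‖f‖_∞`, `Ce^{−r_{k+1}} < ½` (§5 `opNorm_le_of_mulVec_le`,
`norm_mul_le`); any submultiplicative norm would do for §2–§3.  (iii) GENERALITY: arbitrary finite index types, any
invertible `S` (symmetry of `C^{1/2}` is used only in §1), any block map (the print: `LM`-cubes of `Ω_{k+1}`); complex
matrices in §3–§5 with the real case deduced in §6.  (iv) Lemma `r5`'s printed exponent `e^{−½r_{k+1}}` absorbs the
constant `2C`; the file keeps the explicit `2#□‖J‖`.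

**What is NOT claimed.**  The random-walk INPUTS of §3.9 — Lemma 3.5 `\label{th2}` (the `L²` random walk expansion of
`G_{k,Ω⁺,r}`, (security)), Lemma `stem` (1.) (the bounds (around) `|C^{1/2}f|, |(C^{1/2})^{loc}f| ≤ C‖f‖_∞`,
`|δC^{1/2}f| ≤ Ce^{−r_{k+1}}‖f‖_∞` from paths leaving `□^*`), the bound `|C^{−1/2}f| ≤ C‖f‖_∞` of `stem` (2.) (from
Theorem `th`), Lemma 3.8 `\label{r6}` and `b′_k`; the construction of `(C^{1/2})^{loc} = Σ_□ 1_□ C^{1/2}(□^*)` itself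
(L3167–3181) and of `C^{1/2} = π⁻¹∫r^{−1/2}C_r dr` ((z1); the latter is kernel for part I in the sibling
`CovarianceSquareRoot`, (z2)–(z3) = App. C in `FluctuationCovarianceIdentity` — neither imported); the determinant
split (stay1)–(stay3) ∕ (z5) *"(3.22) in [Bal96b]"* (regional vs global determinant, `R^{(6)}` — these are the later
siblings `RegionalLogDeterminant` (v8.81∕v8.84) and `BoundaryDeterminantTerm` (v8.83), not imported here); `R^{(7)}`; anything of
(representation5); anything of B1–B16 (TEMPLATE.md §4.2 row «D2 §3.8 fluctuation integral with (C^{1/2})^{loc} … §3.9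
estimates» ↔ B9 §E ∕ B12 §2 ∕ B13 §1, grade P — untouched; the Bałaban-side twin of the `tr log` Jacobian device is
b12's `Balaban1983to89/B12JacobianTrLog268` for operators `𝒴 →L[ℂ] 𝒴`, NOT imported and not restated).  NOT summit
progress; NOT a statement about any Bałaban paper; NOT continuum; NOT Clay.  Imports: Mathlib + the tree's generic
`Literature.Analysis.Complex.LogOnePlus` (the logarithmic series in a Banach algebra) and `Literature.Analysis.Matrix.DetExp`
(Liouville's formula); no Summits import; sub-namespace `…Dimock2011to13.LocalSquareRootDeterminant`; modifies nothing.
Unit `b2b-balaban-template` gen 34 (journal CLAIM D2-ONIONSTEW-KERNEL); cell records TEMPLATE.md §4.2 row «D2 §3.8»,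
GAPS C-tmpl34-1.  v1.1 (same seat; XREAD l.8745 fold): ADDITIVE — §6 gains the three real-side theorems (the reader's
INFO I-1), two header locators widened ((C^{1/2})^{loc} display L3167–3181, δC^{1/2} display L3182–3186 — DOCFIX-LOW
1–2), the NOT-claimed pointer to the later siblings; every v1 declaration byte-identical.
-/

noncomputable section

open scoped BigOperators Matrix Matrix.Norms.Operator
open Finset NormedSpace

namespace Literature.MathematicalPhysics.QuantumFieldTheory.Dimock2011to13.LocalSquareRootDeterminant

open Literature.Analysis.Complex (logOnePlus logSeriesCoeff hasSum_logOnePlus exp_logOnePlus)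

/-! ## §1 The quadratic form after the change of variables `Z = (C^{1/2})^{loc} W`: the term `R^{(4)}` -/

section QuadForm

variable {m : Type*} [Fintype m] [DecidableEq m]

omit [DecidableEq m] in
/-- `v ⬝ (A w) = (Aᵀ v) ⬝ w`. [folklore] -/
private theorem dotProduct_mulVec_eq_transpose_mulVec_dotProduct (v w : m → ℝ) (A : Matrix m m ℝ) :
    v ⬝ᵥ (A *ᵥ w) = (Aᵀ *ᵥ v) ⬝ᵥ w := by
  rw [Matrix.dotProduct_mulVec, Matrix.mulVec_transpose]

/-- **The quadratic form `½⟨Z, C⁻¹Z⟩` in the variable `W`, `Z = (C^{1/2})^{loc}W = (C^{1/2} − δC^{1/2})W`**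
([Dimock2013BalabanII] §3.8 L3191–3203: *"we make the change of variables Z = (C^{1/2}_{k,Ω′})^{loc}W_k … The
quadratic form ½⟨Z, C^{−1}_{k,Ω′}Z⟩ becomes ½⟨(C^{1/2})^{loc}W_k, C^{−1}(C^{1/2})^{loc}W_k⟩ = ½‖W_k‖² − R^{(4)} where
R^{(4)} = ⟨C^{−1/2}W_k, δC^{1/2}W_k⟩ − ½⟨δC^{1/2}W_k, C^{−1}δC^{1/2}W_k⟩"*), for any symmetric invertible real
matrix `S` (print: `C^{1/2}_{k,Ω′}`, so `C = S²`, `C⁻¹ = (S S)⁻¹`, `C^{−1/2} = S⁻¹`) and any `δ` (print: `δC^{1/2}`):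
`⟨(S − δ)W, (SS)⁻¹(S − δ)W⟩ = ‖W‖² − 2⟨S⁻¹W, δW⟩ + ⟨δW, (SS)⁻¹δW⟩`, i.e. `½⟨Z, C⁻¹Z⟩ = ½‖W‖² − R^{(4)}`.
[cite: Dimock2013BalabanII, §3.8 (arXiv:1212.5562v2 TeX L3191–3203)] -/
theorem quadForm_loc (S δ : Matrix m m ℝ) (hS : Sᵀ = S) (hSu : IsUnit S.det) (W : m → ℝ) :
    ((S - δ) *ᵥ W) ⬝ᵥ ((S * S)⁻¹ *ᵥ ((S - δ) *ᵥ W))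
      = W ⬝ᵥ W - 2 * ((S⁻¹ *ᵥ W) ⬝ᵥ (δ *ᵥ W)) + (δ *ᵥ W) ⬝ᵥ ((S * S)⁻¹ *ᵥ (δ *ᵥ W)) := by
  have hinvT : (S⁻¹)ᵀ = S⁻¹ := by rw [Matrix.transpose_nonsing_inv, hS]
  have hSS : (S * S)⁻¹ = S⁻¹ * S⁻¹ := Matrix.mul_inv_rev S S
  have hSST : ((S * S)⁻¹)ᵀ = (S * S)⁻¹ := by rw [hSS, Matrix.transpose_mul, hinvT]
  -- `C⁻¹ S = S⁻¹`
  have hCS : (S * S)⁻¹ * S = S⁻¹ := by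
    rw [hSS, Matrix.mul_assoc, Matrix.nonsing_inv_mul S hSu, Matrix.mul_one]
  -- `⟨SW, C⁻¹ S W⟩ = ‖W‖²`
  have h1 : (S *ᵥ W) ⬝ᵥ ((S * S)⁻¹ *ᵥ (S *ᵥ W)) = W ⬝ᵥ W := by
    rw [Matrix.mulVec_mulVec, hCS, dotProduct_mulVec_eq_transpose_mulVec_dotProduct, hinvT,
      Matrix.mulVec_mulVec, Matrix.nonsing_inv_mul S hSu, Matrix.one_mulVec]
  -- `⟨SW, C⁻¹ δW⟩ = ⟨S⁻¹W, δW⟩`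
  have h2 : (S *ᵥ W) ⬝ᵥ ((S * S)⁻¹ *ᵥ (δ *ᵥ W)) = (S⁻¹ *ᵥ W) ⬝ᵥ (δ *ᵥ W) := by
    rw [dotProduct_mulVec_eq_transpose_mulVec_dotProduct, hSST, Matrix.mulVec_mulVec, hCS]
  -- `⟨δW, C⁻¹ S W⟩ = ⟨S⁻¹W, δW⟩`
  have h3 : (δ *ᵥ W) ⬝ᵥ ((S * S)⁻¹ *ᵥ (S *ᵥ W)) = (S⁻¹ *ᵥ W) ⬝ᵥ (δ *ᵥ W) := by
    rw [Matrix.mulVec_mulVec, hCS, dotProduct_comm]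
  simp only [Matrix.sub_mulVec, Matrix.mulVec_sub, dotProduct_sub, sub_dotProduct, h1, h2, h3]
  ring

/-- The same identity in Dimock's shape `½⟨Z, C⁻¹Z⟩ = ½‖W‖² − R^{(4)}` with
`R^{(4)} = ⟨S⁻¹W, δW⟩ − ½⟨δW, C⁻¹δW⟩`. [cite: Dimock2013BalabanII, §3.8 (arXiv:1212.5562v2 TeX L3193–3203)] -/
theorem quadForm_loc_half (S δ : Matrix m m ℝ) (hS : Sᵀ = S) (hSu : IsUnit S.det) (W : m → ℝ) :
    (1 / 2 : ℝ) * (((S - δ) *ᵥ W) ⬝ᵥ ((S * S)⁻¹ *ᵥ ((S - δ) *ᵥ W)))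
      = (1 / 2 : ℝ) * (W ⬝ᵥ W)
        - ((S⁻¹ *ᵥ W) ⬝ᵥ (δ *ᵥ W) - (1 / 2 : ℝ) * ((δ *ᵥ W) ⬝ᵥ ((S * S)⁻¹ *ᵥ (δ *ᵥ W)))) := by
  rw [quadForm_loc S δ hS hSu W]
  ring

end QuadForm

/-! ## §2 The logarithmic series of `1 − J` in a Banach algebra -/

section Series

variable {𝔄 : Type*} [NormedRing 𝔄] [NormedAlgebra ℂ 𝔄] [CompleteSpace 𝔄]

omit [CompleteSpace 𝔄] in
/-- Term by term, `log(1 + x)` at `x = −J` is `−Σ_{n≥1} Jⁿ/n`: `((−1)^{n+1}/n)·(−J)ⁿ = −(1/n)·Jⁿ` (and both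
sides vanish at `n = 0`). [folklore] -/
private theorem logSeriesCoeff_smul_neg_pow (J : 𝔄) (n : ℕ) :
    logSeriesCoeff n • (-J) ^ n = (-((1 : ℂ) / n)) • J ^ n := by
  rcases Nat.even_or_odd n with h | h
  · rw [h.neg_pow, logSeriesCoeff, h.add_one.neg_one_pow, neg_div]
  · rw [h.neg_pow, logSeriesCoeff, h.add_one.neg_one_pow, smul_neg, ← neg_smul]

/-- **`log(1 − J) = −Σ_{n=1}^∞ (1/n) Jⁿ`** for `‖J‖ < 1`, as a convergent series in any complete normed
`ℂ`-algebra (the series of (onionstew) in abstract form; the tree's `logOnePlus` at `−J`).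
[cite: Dimock2013BalabanII, §3.8 eq. (onionstew) (arXiv:1212.5562v2 TeX L3211–3218)] -/
theorem hasSum_logOnePlus_neg {J : 𝔄} (hJ : ‖J‖ < 1) :
    HasSum (fun n : ℕ => (-((1 : ℂ) / n)) • J ^ n) (logOnePlus (-J)) := by
  have h := hasSum_logOnePlus (x := -J) (by rwa [norm_neg])
  simpa only [logSeriesCoeff_smul_neg_pow] using h

/-- `exp(log(1 − J)) = 1 − J` for `‖J‖ < 1` (the exponential undoing the logarithm in (onionstew)'s first line
`det((C^{1/2})^{loc}) = det C^{1/2} exp(R^{(5)})`). [cite: Dimock2013BalabanII, §3.8 (arXiv:1212.5562v2 TeX L3205–3218)] -/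
theorem exp_logOnePlus_neg {J : 𝔄} (hJ : ‖J‖ < 1) : exp (logOnePlus (-J)) = 1 - J := by
  rw [exp_logOnePlus (by rwa [norm_neg]), sub_eq_add_neg]

/-- The real majorant: `Σ_{n≥1} tⁿ/n = −log(1 − t)` for `0 ≤ t < 1` (indexed from `n = 0`, where the term is `0`).
[folklore] -/
private theorem hasSum_pow_div (t : ℝ) (h0 : 0 ≤ t) (h1 : t < 1) :
    HasSum (fun n : ℕ => t ^ n / n) (-Real.log (1 - t)) := by
  have h := Real.hasSum_pow_div_log_of_abs_lt_one (x := t) (by rwa [abs_of_nonneg h0])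
  have h' : HasSum (fun n : ℕ => (fun k : ℕ => t ^ k / k) (n + 1)) (-Real.log (1 - t) - ∑ i ∈ range 1, t ^ i / i) := by
    simpa using h
  exact (hasSum_nat_add_iff' 1).mp h'

omit [CompleteSpace 𝔄] in
/-- `‖−(1/n)·Jⁿ‖ ≤ ‖J‖ⁿ/n`. [folklore] -/
private theorem norm_term_le (J : 𝔄) (n : ℕ) : ‖(-((1 : ℂ) / n)) • J ^ n‖ ≤ ‖J‖ ^ n / n := by
  rcases Nat.eq_zero_or_pos n with rfl | hn
  · simp
  · rw [norm_smul, norm_neg, norm_div, norm_one, Complex.norm_natCast, div_mul_eq_mul_div, one_mul]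
    exact div_le_div_of_nonneg_right (norm_pow_le' J hn) (Nat.cast_nonneg n)

/-- `‖log(1 − J)‖ ≤ −log(1 − ‖J‖) = Σ_{n≥1}‖J‖ⁿ/n` for `‖J‖ < 1` (*"summing over n gives the result"*).
[cite: Dimock2013BalabanII, Lemma r5 proof (arXiv:1212.5562v2 TeX L3534–3540)] -/
theorem norm_logOnePlus_neg_le {J : 𝔄} (hJ : ‖J‖ < 1) : ‖logOnePlus (-J)‖ ≤ -Real.log (1 - ‖J‖) :=
  (hasSum_logOnePlus_neg hJ).norm_le_of_bounded (hasSum_pow_div ‖J‖ (norm_nonneg J) hJ) (norm_term_le J)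

/-- The elementary chain `−log(1 − t) ≤ t/(1 − t) ≤ 2t` for `0 ≤ t ≤ ½`. [folklore] -/
private theorem neg_log_one_sub_le_two_mul {t : ℝ} (h0 : 0 ≤ t) (h1 : t ≤ 1 / 2) : -Real.log (1 - t) ≤ 2 * t := by
  have ht1 : 0 < 1 - t := by linarith
  have key : -Real.log (1 - t) ≤ t / (1 - t) := by
    have := Real.one_sub_inv_le_log_of_pos ht1
    have hrew : 1 - (1 - t)⁻¹ = -(t / (1 - t)) := by field_simp; ring
    linarith [hrew ▸ this]
  calc -Real.log (1 - t) ≤ t / (1 - t) := key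
    _ ≤ t / (1 / 2) := by
        apply div_le_div_of_nonneg_left h0 (by norm_num) (by linarith)
    _ = 2 * t := by ring

end Series

/-! ## §3 Matrices: trace and determinant of `log(1 − J)` — the identity (onionstew) ← "(2.41) in [Bal98a]" -/

section Matrices

variable {m : Type*} [Fintype m] [DecidableEq m]

/-- `‖tr M‖ ≤ #m · ‖M‖` in the `ℓ^∞`-operator norm. [folklore] -/
private theorem norm_trace_le (M : Matrix m m ℂ) : ‖M.trace‖ ≤ Fintype.card m * ‖M‖ := by
  calc ‖M.trace‖ = ‖∑ i, M i i‖ := rfl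
    _ ≤ ∑ i, ‖M i i‖ := norm_sum_le _ _
    _ ≤ ∑ _i : m, ‖M‖ := sum_le_sum fun i _ => Literature.Analysis.Matrix.norm_apply_le_linfty_opNorm M i i
    _ = Fintype.card m * ‖M‖ := by simp

/-- The trace as a continuous linear functional (for the `ℓ^∞`-operator norm). [folklore] -/
def traceCLM (m : Type*) [Fintype m] [DecidableEq m] : Matrix m m ℂ →L[ℂ] ℂ :=
  (Matrix.traceLinearMap m ℂ ℂ).mkContinuous (Fintype.card m) fun M => norm_trace_le M

/-- `traceCLM` is the trace. [folklore] -/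
private theorem traceCLM_apply (M : Matrix m m ℂ) : traceCLM m M = M.trace := rfl

/-- **`tr log(1 − J) = −Σ_{n=1}^∞ (1/n) tr(Jⁿ)`** for a complex matrix with `‖J‖ < 1` (`ℓ^∞`-operator norm) —
the second equality of (onionstew). [cite: Dimock2013BalabanII, §3.8 eq. (onionstew) (arXiv:1212.5562v2 TeX L3211–3218)] -/
theorem hasSum_trace_logOnePlus_neg {J : Matrix m m ℂ} (hJ : ‖J‖ < 1) :
    HasSum (fun n : ℕ => -((1 : ℂ) / n) * (J ^ n).trace) (logOnePlus (-J)).trace := by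
  have h := (hasSum_logOnePlus_neg hJ).mapL (traceCLM m)
  simpa only [traceCLM_apply, Matrix.trace_smul, smul_eq_mul] using h

/-- **`det(1 − J) = exp(tr log(1 − J))`** for a complex matrix with `‖J‖ < 1`: `exp log(1 − J) = 1 − J` in the
Banach algebra of matrices and Liouville's formula `det e^X = e^{tr X}` (tree: `Literature.Analysis.Matrix.det_exp_eq_exp_trace`).
[cite: Dimock2013BalabanII, §3.8 eq. (onionstew) (arXiv:1212.5562v2 TeX L3205–3218)] -/
theorem det_one_sub_eq_cexp_trace {J : Matrix m m ℂ} (hJ : ‖J‖ < 1) :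
    (1 - J).det = Complex.exp (logOnePlus (-J)).trace := by
  have h := exp_logOnePlus_neg hJ
  have hdet := Literature.Analysis.Matrix.det_exp_eq_exp_trace (logOnePlus (-J))
  rw [Complex.exp_eq_exp_ℂ, ← h]
  exact hdet

/-- `|tr log(1 − J)| ≤ #m · (−log(1 − ‖J‖))` (*"Summing over y … gives the factor (LM)³ and summing over n gives the
result"*, for the whole lattice). [cite: Dimock2013BalabanII, Lemma r5 proof (arXiv:1212.5562v2 TeX L3534–3540)] -/
theorem norm_trace_logOnePlus_neg_le {J : Matrix m m ℂ} (hJ : ‖J‖ < 1) :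
    ‖(logOnePlus (-J)).trace‖ ≤ Fintype.card m * (-Real.log (1 - ‖J‖)) :=
  (norm_trace_le _).trans (mul_le_mul_of_nonneg_left (norm_logOnePlus_neg_le hJ) (Nat.cast_nonneg _))

/-- `det(S − SJ) = det S · exp(tr log(1 − J))` for ANY square `S` and `‖J‖ < 1` (the determinant line of (onionstew)
before substituting `J = C^{−1/2}δC^{1/2}`). [cite: Dimock2013BalabanII, §3.8 (arXiv:1212.5562v2 TeX L3205–3218)] -/
theorem det_sub_mul_eq_det_mul_cexp (S : Matrix m m ℂ) {J : Matrix m m ℂ} (hJ : ‖J‖ < 1) :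
    (S - S * J).det = S.det * Complex.exp (logOnePlus (-J)).trace := by
  rw [← det_one_sub_eq_cexp_trace hJ, ← Matrix.det_mul, Matrix.mul_sub, Matrix.mul_one]

/-- **`R^{(5)}`** of (onionstew) for an invertible `S` (print: `C^{1/2}_{k,Ω′}`) and a perturbation `δ` (print:
`δC^{1/2}_{k,Ω′}`, so `(C^{1/2})^{loc} = S − δ`): `R^{(5)} := tr log(1 − S⁻¹δ) = tr log(S⁻¹(S − δ))`, the convergent
series `−Σ_{n≥1}(1/n) tr((S⁻¹δ)ⁿ)` when `‖S⁻¹δ‖ < 1`. [cite: Dimock2013BalabanII, §3.8 eq. (onionstew) (arXiv:1212.5562v2 TeX L3211–3218)] -/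
def R5 (S δ : Matrix m m ℂ) : ℂ := (logOnePlus (-(S⁻¹ * δ))).trace

/-- **(onionstew), the series**: `R^{(5)} = −Σ_{n=1}^∞ (1/n) tr((C^{−1/2}δC^{1/2})ⁿ)` — *"For the last identity see
(2.41) in [Bal98a]"* — PROVED for matrices under `‖C^{−1/2}δC^{1/2}‖ < 1` in the `ℓ^∞`-operator (sup-norm) operator
norm. [cite: Dimock2013BalabanII, §3.8 eq. (onionstew) (arXiv:1212.5562v2 TeX L3211–3218)] -/
theorem hasSum_R5 {S δ : Matrix m m ℂ} (hJ : ‖S⁻¹ * δ‖ < 1) :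
    HasSum (fun n : ℕ => -((1 : ℂ) / n) * ((S⁻¹ * δ) ^ n).trace) (R5 S δ) :=
  hasSum_trace_logOnePlus_neg hJ

/-- **(onionstew), the determinant**: `det((C^{1/2})^{loc}) = det(C^{1/2}) · exp(R^{(5)})` with `(C^{1/2})^{loc} =
C^{1/2} − δC^{1/2}` — *"The change of variables also introduces det((C^{1/2}_{k,Ω′})^{loc}) = det C^{1/2}_{k,Ω′}
exp(R^{(5)}_{Π,Ω_{k+1}})"* (L3205–3209) — PROVED for every invertible complex matrix `S` and every `δ` with
`‖S⁻¹δ‖ < 1`. [cite: Dimock2013BalabanII, §3.8 (arXiv:1212.5562v2 TeX L3205–3218)] -/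
theorem det_loc_eq_det_mul_cexp_R5 {S δ : Matrix m m ℂ} (hS : IsUnit S.det) (hJ : ‖S⁻¹ * δ‖ < 1) :
    (S - δ).det = S.det * Complex.exp (R5 S δ) := by
  have hfac : S - δ = S - S * (S⁻¹ * δ) := by
    rw [← Matrix.mul_assoc, Matrix.mul_nonsing_inv S hS, Matrix.one_mul]
  rw [hfac, det_sub_mul_eq_det_mul_cexp S hJ, R5]

/-- `exp(R^{(5)}) ≠ 0`, so `(C^{1/2})^{loc}` is invertible with `C^{1/2}` (*"C^{1/2}_{k,Ω′} and (C^{1/2}_{k,Ω′})^{loc} are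
invertible"*). [cite: Dimock2013BalabanII, Lemma stem (2.) (arXiv:1212.5562v2 TeX L3440–3445)] -/
theorem isUnit_det_loc {S δ : Matrix m m ℂ} (hS : IsUnit S.det) (hJ : ‖S⁻¹ * δ‖ < 1) : IsUnit (S - δ).det := by
  rw [det_loc_eq_det_mul_cexp_R5 hS hJ, isUnit_iff_ne_zero]
  exact mul_ne_zero hS.ne_zero (Complex.exp_ne_zero _)

/-- The size of `R^{(5)}` from the operator smallness: `|R^{(5)}| ≤ #m · (−log(1 − ‖S⁻¹δ‖))` (`≤ 2#m‖S⁻¹δ‖` when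
`‖S⁻¹δ‖ ≤ ½`) — the global form of Lemma `r5`'s count *"Summing over y ∈ □ gives the factor (LM)³ and summing over n
gives the result"*. [cite: Dimock2013BalabanII, Lemma r5 proof (arXiv:1212.5562v2 TeX L3527–3540)] -/
theorem norm_R5_le {S δ : Matrix m m ℂ} (hJ : ‖S⁻¹ * δ‖ < 1) :
    ‖R5 S δ‖ ≤ Fintype.card m * (-Real.log (1 - ‖S⁻¹ * δ‖)) :=
  norm_trace_logOnePlus_neg_le hJ

/-- `|R^{(5)}| ≤ 2#m‖C^{−1/2}δC^{1/2}‖` when `‖C^{−1/2}δC^{1/2}‖ ≤ ½`. [cite: Dimock2013BalabanII, Lemma r5 (arXiv:1212.5562v2 TeX L3516–3540)] -/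
theorem norm_R5_le_two_mul {S δ : Matrix m m ℂ} (hJ : ‖S⁻¹ * δ‖ ≤ 1 / 2) :
    ‖R5 S δ‖ ≤ 2 * Fintype.card m * ‖S⁻¹ * δ‖ := by
  have hJ1 : ‖S⁻¹ * δ‖ < 1 := hJ.trans_lt (by norm_num)
  calc ‖R5 S δ‖ ≤ Fintype.card m * (-Real.log (1 - ‖S⁻¹ * δ‖)) := norm_R5_le hJ1
    _ ≤ Fintype.card m * (2 * ‖S⁻¹ * δ‖) :=
        mul_le_mul_of_nonneg_left (neg_log_one_sub_le_two_mul (norm_nonneg _) hJ) (Nat.cast_nonneg _)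
    _ = 2 * Fintype.card m * ‖S⁻¹ * δ‖ := by ring

end Matrices

/-! ## §4 Lemma 3.7 (`r5`): the local expansion `R^{(5)} = Σ_□ R^{(5)}(□)` and its bound -/

section LocalExpansion

variable {m : Type*} [Fintype m] [DecidableEq m]

/-- The printed form of the diagonal entry: `(Jⁿ)_{yy} = ((Jⁿ)δ_y)(y)` with `δ_y = Pi.single y 1` ((spiffy)'s second
expression). [cite: Dimock2013BalabanII, Lemma r5 eq. (spiffy) (arXiv:1212.5562v2 TeX L3527–3533)] -/
theorem pow_apply_eq_mulVec_single (J : Matrix m m ℂ) (n : ℕ) (y : m) :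
    (J ^ n) y y = ((J ^ n) *ᵥ Pi.single y 1) y := by
  rw [Matrix.mulVec_single_one]; rfl

variable {B : Type*} [DecidableEq B]

/-- The block (print: the `LM`-cube `□ ⊂ Ω_{k+1}`) of the block map `cube` over `b`: the sites `y` with `cube y = b`.
[folklore] -/
def block (cube : m → B) (b : B) : Finset m := univ.filter fun y => cube y = b

omit [DecidableEq m] in
/-- Membership in a block. [folklore] -/
private theorem mem_block {cube : m → B} {b : B} {y : m} : y ∈ block cube b ↔ cube y = b := by
  simp [block]

/-- **`R^{(5)}(□) := −Σ_{n=1}^∞ (1/n) Σ_{y∈□} ((C^{−1/2}δC^{1/2})ⁿ δ_y)(y)`** — the `□`-term of the local expansion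
(spiffy) of Lemma `r5` (the diagonal entries `(Jⁿ)_{yy} = (Jⁿδ_y)(y)` of the block `□`).
[cite: Dimock2013BalabanII, Lemma r5 eq. (spiffy) (arXiv:1212.5562v2 TeX L3527–3533)] -/
def R5loc (J : Matrix m m ℂ) (cube : m → B) (b : B) : ℂ :=
  ∑' n : ℕ, -((1 : ℂ) / n) * ∑ y ∈ block cube b, (J ^ n) y y

/-- The majorant of one block term: `‖−(1/n) Σ_{y∈□}(Jⁿ)_{yy}‖ ≤ #□ · ‖J‖ⁿ/n` (each diagonal entry is bounded by
the `ℓ^∞`-operator norm `‖Jⁿ‖ ≤ ‖J‖ⁿ` — Dimock: *"|((C^{−1/2}δC^{1/2})ⁿδ_y)(y)| ≤ (Ce^{−r_{k+1}})ⁿ‖δ_y‖_∞"*).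
[cite: Dimock2013BalabanII, Lemma r5 proof (arXiv:1212.5562v2 TeX L3534–3540)] -/
theorem norm_blockTerm_le (J : Matrix m m ℂ) (cube : m → B) (b : B) (n : ℕ) :
    ‖-((1 : ℂ) / n) * ∑ y ∈ block cube b, (J ^ n) y y‖ ≤ (block cube b).card * (‖J‖ ^ n / n) := by
  rcases Nat.eq_zero_or_pos n with rfl | hn
  · simp
  · have hdiag : ∀ y ∈ block cube b, ‖(J ^ n) y y‖ ≤ ‖J‖ ^ n := fun y _ =>
      (Literature.Analysis.Matrix.norm_apply_le_linfty_opNorm (J ^ n) y y).trans (norm_pow_le' J hn)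
    calc ‖-((1 : ℂ) / n) * ∑ y ∈ block cube b, (J ^ n) y y‖
        = (1 / n) * ‖∑ y ∈ block cube b, (J ^ n) y y‖ := by
          rw [norm_mul, norm_neg, norm_div, norm_one, Complex.norm_natCast]
      _ ≤ (1 / n) * ∑ y ∈ block cube b, ‖(J ^ n) y y‖ := by
          gcongr; exact norm_sum_le _ _
      _ ≤ (1 / n) * ∑ _y ∈ block cube b, ‖J‖ ^ n := by gcongr with y hy; exact hdiag y hy
      _ = (block cube b).card * (‖J‖ ^ n / n) := by rw [sum_const, nsmul_eq_mul]; ring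

/-- The block series converges absolutely for `‖J‖ < 1` and sums to `R^{(5)}(□)`.
[cite: Dimock2013BalabanII, Lemma r5 eq. (spiffy) (arXiv:1212.5562v2 TeX L3527–3540)] -/
theorem hasSum_R5loc {J : Matrix m m ℂ} (hJ : ‖J‖ < 1) (cube : m → B) (b : B) :
    HasSum (fun n : ℕ => -((1 : ℂ) / n) * ∑ y ∈ block cube b, (J ^ n) y y) (R5loc J cube b) := by
  have hmaj : Summable fun n : ℕ => ((block cube b).card : ℝ) * (‖J‖ ^ n / n) :=
    ((hasSum_pow_div ‖J‖ (norm_nonneg J) hJ).mul_left _).summable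
  exact (Summable.of_norm_bounded hmaj (norm_blockTerm_le J cube b)).hasSum

/-- **Lemma `r5`, the bound**: `|R^{(5)}(□)| ≤ #□ · (−log(1 − ‖J‖))` for `‖J‖ < 1` — *"Summing over y ∈ □ gives the
factor (LM)³ and summing over n gives the result"* (`#□ = (LM)³` in the print, `‖J‖ = Ce^{−r_{k+1}}`).
[cite: Dimock2013BalabanII, Lemma r5 (arXiv:1212.5562v2 TeX L3516–3540)] -/
theorem norm_R5loc_le {J : Matrix m m ℂ} (hJ : ‖J‖ < 1) (cube : m → B) (b : B) :
    ‖R5loc J cube b‖ ≤ (block cube b).card * (-Real.log (1 - ‖J‖)) :=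
  (hasSum_R5loc hJ cube b).norm_le_of_bounded ((hasSum_pow_div ‖J‖ (norm_nonneg J) hJ).mul_left _)
    (norm_blockTerm_le J cube b)

/-- The same with the elementary `−log(1 − θ) ≤ 2θ` (`θ ≤ ½`): `|R^{(5)}(□)| ≤ 2 #□ ‖J‖` — Dimock's
`C(LM)³e^{−r_{k+1}}`-type bound (he records it as `C(LM)³e^{−½r_{k+1}}`). [cite: Dimock2013BalabanII, Lemma r5 (arXiv:1212.5562v2 TeX L3516–3521)] -/
theorem norm_R5loc_le_two_mul {J : Matrix m m ℂ} (hJ : ‖J‖ ≤ 1 / 2) (cube : m → B) (b : B) :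
    ‖R5loc J cube b‖ ≤ 2 * (block cube b).card * ‖J‖ := by
  have hJ1 : ‖J‖ < 1 := hJ.trans_lt (by norm_num)
  calc ‖R5loc J cube b‖ ≤ (block cube b).card * (-Real.log (1 - ‖J‖)) := norm_R5loc_le hJ1 cube b
    _ ≤ (block cube b).card * (2 * ‖J‖) :=
        mul_le_mul_of_nonneg_left (neg_log_one_sub_le_two_mul (norm_nonneg _) hJ) (Nat.cast_nonneg _)
    _ = 2 * (block cube b).card * ‖J‖ := by ring

/-- **Lemma `r5`, the local expansion**: `R^{(5)} = Σ_□ R^{(5)}(□)` — summing the block terms over all blocks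
reassembles `tr log(1 − J) = −Σ_n (1/n) tr(Jⁿ)` (the trace is the sum of the diagonal over the blocks).
[cite: Dimock2013BalabanII, Lemma r5 (arXiv:1212.5562v2 TeX L3516–3533)] -/
theorem sum_R5loc_eq [Fintype B] {J : Matrix m m ℂ} (hJ : ‖J‖ < 1) (cube : m → B) :
    ∑ b, R5loc J cube b = (logOnePlus (-J)).trace := by
  have hsum : HasSum (fun n : ℕ => ∑ b, -((1 : ℂ) / n) * ∑ y ∈ block cube b, (J ^ n) y y)
      (∑ b, R5loc J cube b) := hasSum_sum fun b _ => hasSum_R5loc hJ cube b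
  have hre : (fun n : ℕ => ∑ b, -((1 : ℂ) / n) * ∑ y ∈ block cube b, (J ^ n) y y)
      = fun n : ℕ => -((1 : ℂ) / n) * (J ^ n).trace := by
    funext n
    rw [← mul_sum, Matrix.trace]
    congr 1
    exact sum_fiberwise univ cube fun y => (J ^ n) y y
  rw [hre] at hsum
  exact hsum.unique (hasSum_trace_logOnePlus_neg hJ)

/-- Hence, for `(C^{1/2})^{loc} = S − δ` with `‖S⁻¹δ‖ < 1`: `R^{(5)} = Σ_□ R^{(5)}(□)` with `J = S⁻¹δ = C^{−1/2}δC^{1/2}`.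
[cite: Dimock2013BalabanII, Lemma r5 (arXiv:1212.5562v2 TeX L3516–3533)] -/
theorem R5_eq_sum_R5loc [Fintype B] {S δ : Matrix m m ℂ} (hJ : ‖S⁻¹ * δ‖ < 1) (cube : m → B) :
    R5 S δ = ∑ b, R5loc (S⁻¹ * δ) cube b :=
  (sum_R5loc_eq hJ cube).symm

end LocalExpansion

/-! ## §5 Lemma 3.6 (`stem`) part 2: the Neumann inversion of `(C^{1/2})^{loc} = C^{1/2} − δC^{1/2}` -/

section Neumann

variable {m : Type*} [Fintype m] [DecidableEq m]

/-- **`[(C^{1/2})^{loc}]⁻¹ = C^{−1/2} Σ_{n=0}^∞ (δC^{1/2} C^{−1/2})ⁿ`** — *"the inverse is realized as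
[(C^{1/2}_{k,Ω′})^{loc}]^{−1} = C^{−1/2}_{k,Ω′} Σ_{n=0}^∞ (δC^{1/2}_{k,Ω′} C^{−1/2}_{k,Ω′})ⁿ"* — for every invertible
`S` (print `C^{1/2}`) and `δ` with `‖δS⁻¹‖ < 1` (the geometric series in the Banach algebra of matrices).
[cite: Dimock2013BalabanII, Lemma stem (2.) proof (arXiv:1212.5562v2 TeX L3506–3512)] -/
theorem inv_loc_eq {S δ : Matrix m m ℂ} (hS : IsUnit S.det) (h : ‖δ * S⁻¹‖ < 1) :
    (S - δ)⁻¹ = S⁻¹ * ∑' n : ℕ, (δ * S⁻¹) ^ n := by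
  have hfac : S - δ = (1 - δ * S⁻¹) * S := by
    rw [Matrix.sub_mul, Matrix.one_mul, Matrix.mul_assoc, Matrix.nonsing_inv_mul S hS, Matrix.mul_one]
  apply Matrix.inv_eq_right_inv
  rw [hfac, Matrix.mul_assoc, ← Matrix.mul_assoc S, Matrix.mul_nonsing_inv S hS, Matrix.one_mul]
  exact mul_neg_geom_series _ h

/-- `(C^{1/2})^{loc} = (1 − δS⁻¹)S` is invertible when `‖δS⁻¹‖ < 1` (the factor `1 − δS⁻¹` is a unit of the Banach
algebra by the geometric series) — *"(C^{1/2}_{k,Ω′})^{loc} [is] invertible"*.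
[cite: Dimock2013BalabanII, Lemma stem (2.) (arXiv:1212.5562v2 TeX L3440–3445, L3506–3512)] -/
theorem isUnit_det_loc_of_norm_lt {S δ : Matrix m m ℂ} (hS : IsUnit S.det) (h : ‖δ * S⁻¹‖ < 1) :
    IsUnit (S - δ).det := by
  have hfac : S - δ = (1 - δ * S⁻¹) * S := by
    rw [Matrix.sub_mul, Matrix.one_mul, Matrix.mul_assoc, Matrix.nonsing_inv_mul S hS, Matrix.mul_one]
  have h1 : IsUnit (1 - δ * S⁻¹ : Matrix m m ℂ) := ⟨Units.oneSub _ h, rfl⟩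
  rw [hfac, Matrix.det_mul]
  exact ((Matrix.isUnit_iff_isUnit_det _).mp h1).mul hS

/-- The geometric series realises the inverse: `(S − δ)·[S⁻¹ Σ (δS⁻¹)ⁿ] = 1`.
[cite: Dimock2013BalabanII, Lemma stem (2.) proof (arXiv:1212.5562v2 TeX L3506–3512)] -/
theorem loc_mul_inv_series {S δ : Matrix m m ℂ} (hS : IsUnit S.det) (h : ‖δ * S⁻¹‖ < 1) :
    (S - δ) * (S⁻¹ * ∑' n : ℕ, (δ * S⁻¹) ^ n) = 1 := by
  rw [← inv_loc_eq hS h]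
  exact Matrix.mul_nonsing_inv _ (isUnit_det_loc_of_norm_lt hS h)

variable [Nonempty m]

/-- **Lemma `stem` (2.), the bound**: if `‖C^{−1/2}‖ ≤ c`, `‖δC^{1/2}‖ ≤ ε` and `cε ≤ ½` then
`‖[(C^{1/2})^{loc}]⁻¹‖ ≤ 2c` (`ℓ^∞`-operator norms, i.e. sup-norm operator bounds) — *"The convergence and the bound
then follow from |C^{−1/2}f| ≤ C‖f‖_∞ and |δC^{1/2}f| ≤ e^{−r_{k+1}}‖f‖_∞, since we can assume Ce^{−r_{k+1}} < ½"*.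
[cite: Dimock2013BalabanII, Lemma stem (2.) (arXiv:1212.5562v2 TeX L3442–3445, L3506–3512)] -/
theorem norm_inv_loc_le {S δ : Matrix m m ℂ} (hS : IsUnit S.det) {c ε : ℝ} (hc : ‖S⁻¹‖ ≤ c) (hε : ‖δ‖ ≤ ε)
    (hcε : c * ε ≤ 1 / 2) : ‖(S - δ)⁻¹‖ ≤ 2 * c := by
  have hc0 : 0 ≤ c := (norm_nonneg _).trans hc
  have hx : ‖δ * S⁻¹‖ ≤ 1 / 2 :=
    (norm_mul_le _ _).trans ((mul_le_mul hε hc (norm_nonneg _) ((norm_nonneg _).trans hε)).trans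
      (by rwa [mul_comm]))
  have hx1 : ‖δ * S⁻¹‖ < 1 := hx.trans_lt (by norm_num)
  have hgeom : ‖∑' n : ℕ, (δ * S⁻¹) ^ n‖ ≤ 2 := by
    refine (tsum_geometric_le_of_norm_lt_one (δ * S⁻¹) hx1).trans ?_
    rw [norm_one, sub_self, zero_add]
    calc (1 - ‖δ * S⁻¹‖)⁻¹ ≤ (1 - 1 / 2 : ℝ)⁻¹ := inv_anti₀ (by norm_num) (sub_le_sub_left hx 1)
      _ = 2 := by norm_num
  rw [inv_loc_eq hS hx1]
  calc ‖S⁻¹ * ∑' n : ℕ, (δ * S⁻¹) ^ n‖ ≤ ‖S⁻¹‖ * ‖∑' n : ℕ, (δ * S⁻¹) ^ n‖ := norm_mul_le _ _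
    _ ≤ c * 2 := mul_le_mul hc hgeom (norm_nonneg _) hc0
    _ = 2 * c := mul_comm _ _

/-- The sup-norm reading: `|[(C^{1/2})^{loc}]⁻¹ f| ≤ 2c ‖f‖_∞` pointwise (the `ℓ^∞`-operator norm IS the sup-norm
operator bound, `Matrix.linfty_opNorm_mulVec`). [cite: Dimock2013BalabanII, Lemma stem (2.) eq. (steaming) (arXiv:1212.5562v2 TeX L3442–3445)] -/
theorem norm_inv_loc_mulVec_le {S δ : Matrix m m ℂ} (hS : IsUnit S.det) {c ε : ℝ} (hc : ‖S⁻¹‖ ≤ c)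
    (hε : ‖δ‖ ≤ ε) (hcε : c * ε ≤ 1 / 2) (f : m → ℂ) : ‖(S - δ)⁻¹ *ᵥ f‖ ≤ 2 * c * ‖f‖ :=
  (Matrix.linfty_opNorm_mulVec _ _).trans
    (mul_le_mul_of_nonneg_right (norm_inv_loc_le hS hc hε hcε) (norm_nonneg _))

omit [DecidableEq m] [Nonempty m] in
/-- Conversely, a sup-norm operator bound `∀ f, ‖Jf‖_∞ ≤ θ‖f‖_∞` (the form in which Lemma `stem` states (around),
(steaming)) gives `‖J‖ ≤ θ` in the `ℓ^∞`-operator norm, so the hypotheses above are Dimock's.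
[cite: Dimock2013BalabanII, Lemma stem eqs. (around), (steaming) (arXiv:1212.5562v2 TeX L3433–3445)] -/
theorem opNorm_le_of_mulVec_le {n : Type*} [Fintype n] (J : Matrix m n ℂ) {θ : ℝ} (hθ : 0 ≤ θ)
    (h : ∀ f : n → ℂ, ‖J *ᵥ f‖ ≤ θ * ‖f‖) : ‖J‖ ≤ θ := by
  rw [Matrix.linfty_opNorm_eq_opNorm]
  exact ContinuousLinearMap.opNorm_le_bound _ hθ fun f => by simpa using h f

end Neumann

/-! ## §6 Real matrices (Dimock's operators act on real functions `W_k : Ω^{(k)}_{k+1} → ℝ`) -/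

section RealMatrices

variable {m : Type*} [Fintype m]

/-- Complexification of a real matrix (entrywise). [folklore] -/
abbrev cplx (M : Matrix m m ℝ) : Matrix m m ℂ := M.map Complex.ofReal

/-- The `ℓ^∞`-operator norm is unchanged by complexification. [folklore] -/
private theorem norm_cplx (M : Matrix m m ℝ) : ‖cplx M‖ = ‖M‖ := by
  simp only [Matrix.linfty_opNorm_def, Matrix.map_apply]
  congr 1
  refine Finset.sup_congr rfl fun i _ => Finset.sum_congr rfl fun j _ => ?_
  ext; simp

variable [DecidableEq m]

/-- `cplx` is the ring homomorphism `Complex.ofRealHom.mapMatrix`. [folklore] -/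
private theorem cplx_eq_mapMatrix (M : Matrix m m ℝ) : cplx M = Complex.ofRealHom.mapMatrix M := rfl

/-- **`R^{(5)}` of a real `J = C^{−1/2}δC^{1/2}`**: the real number `Re tr log(1 − J_ℂ)` (the imaginary part vanishes,
`im_trace_logOnePlus_neg_cplx`). [cite: Dimock2013BalabanII, §3.8 eq. (onionstew) (arXiv:1212.5562v2 TeX L3211–3218)] -/
def R5real (J : Matrix m m ℝ) : ℝ := (logOnePlus (-cplx J)).trace.re

/-- The complexified trace series has real terms. [folklore] -/
private theorem hasSum_trace_cplx {J : Matrix m m ℝ} (hJ : ‖J‖ < 1) :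
    HasSum (fun n : ℕ => ((-((1 : ℝ) / n) * (J ^ n).trace : ℝ) : ℂ)) (logOnePlus (-cplx J)).trace := by
  have h := hasSum_trace_logOnePlus_neg (J := cplx J) (by rwa [norm_cplx])
  convert h using 2 with n
  rw [cplx_eq_mapMatrix, ← RingHom.map_pow]
  simp [Matrix.trace, RingHom.mapMatrix_apply, Matrix.map_apply]

/-- **(onionstew) for real matrices, the series**: `R^{(5)} = −Σ_{n≥1}(1/n) tr(Jⁿ)` converges (in `ℝ`) for `‖J‖ < 1`.
[cite: Dimock2013BalabanII, §3.8 eq. (onionstew) (arXiv:1212.5562v2 TeX L3211–3218)] -/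
theorem hasSum_R5real {J : Matrix m m ℝ} (hJ : ‖J‖ < 1) :
    HasSum (fun n : ℕ => -((1 : ℝ) / n) * (J ^ n).trace) (R5real J) := by
  have h := (hasSum_trace_cplx hJ).mapL Complex.reCLM
  simpa [R5real] using h

/-- The imaginary part of `tr log(1 − J_ℂ)` vanishes for real `J`. [folklore] -/
private theorem im_trace_logOnePlus_neg_cplx {J : Matrix m m ℝ} (hJ : ‖J‖ < 1) : (logOnePlus (-cplx J)).trace.im = 0 := by
  have h := (hasSum_trace_cplx hJ).mapL Complex.imCLM
  simp only [Complex.imCLM_apply, Complex.ofReal_im] at h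
  exact h.unique hasSum_zero

/-- `tr log(1 − J_ℂ) = R5real J` as a complex number. [folklore] -/
private theorem trace_logOnePlus_neg_cplx_eq {J : Matrix m m ℝ} (hJ : ‖J‖ < 1) :
    (logOnePlus (-cplx J)).trace = (R5real J : ℂ) := by
  apply Complex.ext <;> simp [R5real, im_trace_logOnePlus_neg_cplx hJ]

/-- **(onionstew) for real matrices, the determinant**: for a real invertible `S` (print `C^{1/2}_{k,Ω′}`) and real
`δ` (print `δC^{1/2}_{k,Ω′}`) with `‖S⁻¹δ‖ < 1`: `det(S − δ) = det S · e^{R^{(5)}}`, `R^{(5)} = −Σ_{n≥1}(1/n)tr((S⁻¹δ)ⁿ) ∈ ℝ`.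
[cite: Dimock2013BalabanII, §3.8 (arXiv:1212.5562v2 TeX L3205–3218)] -/
theorem det_loc_eq_det_mul_rexp {S δ : Matrix m m ℝ} (hS : IsUnit S.det) (hJ : ‖S⁻¹ * δ‖ < 1) :
    (S - δ).det = S.det * Real.exp (R5real (S⁻¹ * δ)) := by
  have hJc : ‖cplx (S⁻¹ * δ)‖ < 1 := by rwa [norm_cplx]
  have hc := det_sub_mul_eq_det_mul_cexp (cplx S) hJc
  have hmul : cplx S * cplx (S⁻¹ * δ) = cplx δ := by
    rw [cplx_eq_mapMatrix, cplx_eq_mapMatrix, ← RingHom.map_mul, ← Matrix.mul_assoc, Matrix.mul_nonsing_inv S hS,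
      Matrix.one_mul, ← cplx_eq_mapMatrix]
  rw [hmul, trace_logOnePlus_neg_cplx_eq hJ, ← Complex.ofReal_exp] at hc
  have hdet : ∀ M : Matrix m m ℝ, (cplx M).det = (M.det : ℂ) := fun M => by
    rw [cplx_eq_mapMatrix, ← RingHom.map_det]; rfl
  have hsub : cplx S - cplx δ = cplx (S - δ) := by
    rw [cplx_eq_mapMatrix, cplx_eq_mapMatrix, cplx_eq_mapMatrix, ← RingHom.map_sub]
  rw [hsub, hdet, hdet] at hc
  exact_mod_cast hc

/-- **Lemma `r5`'s local expansion on the REAL side** (v1.1): for a real `J` (print: `C^{−1/2}_{k,Ω′}δC^{1/2}_{k,Ω′}`)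
with `‖J‖ < 1`, `R^{(5)} = Σ_□ Re R^{(5)}(□)` — the block terms of §4 taken for the complexified matrix have real sum
`R5real J` (their imaginary parts are not claimed to vanish blockwise; the print's `R^{(5)}(□)` is real, and `Re` of the
complex block term is that real number). [cite: Dimock2013BalabanII, Lemma r5 (arXiv:1212.5562v2 TeX L3516–3533)] -/
theorem R5real_eq_sum_re_R5loc {B : Type*} [Fintype B] [DecidableEq B] {J : Matrix m m ℝ} (hJ : ‖J‖ < 1)
    (cube : m → B) :
    R5real J = ∑ b, (R5loc (cplx J) cube b).re := by
  have hJc : ‖cplx J‖ < 1 := by rwa [norm_cplx]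
  rw [R5real, ← sum_R5loc_eq hJc cube, Complex.re_sum]

/-- the per-cube bound on the real side: `|Re R^{(5)}(□)| ≤ #□·(−log(1 − ‖J‖))` (the `ℓ^∞` operator norm of the real
matrix). [cite: Dimock2013BalabanII, Lemma r5 (arXiv:1212.5562v2 TeX L3516–3540)] -/
theorem abs_re_R5loc_le {B : Type*} [DecidableEq B] {J : Matrix m m ℝ} (hJ : ‖J‖ < 1) (cube : m → B) (b : B) :
    |(R5loc (cplx J) cube b).re| ≤ (block cube b).card * (-Real.log (1 - ‖J‖)) := by
  have hJc : ‖cplx J‖ < 1 := by rwa [norm_cplx]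
  have h := norm_R5loc_le hJc cube b
  rw [norm_cplx] at h
  exact (Complex.abs_re_le_norm _).trans h

/-- … and `|Re R^{(5)}(□)| ≤ 2#□‖J‖` for `‖J‖ ≤ ½` (Dimock's `C(LM)³e^{−r_{k+1}}`-type bound with `‖J‖ = Ce^{−r_{k+1}}`).
[cite: Dimock2013BalabanII, Lemma r5 (arXiv:1212.5562v2 TeX L3516–3521)] -/
theorem abs_re_R5loc_le_two_mul {B : Type*} [DecidableEq B] {J : Matrix m m ℝ} (hJ : ‖J‖ ≤ 1 / 2) (cube : m → B)
    (b : B) :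
    |(R5loc (cplx J) cube b).re| ≤ 2 * (block cube b).card * ‖J‖ := by
  have hJc : ‖cplx J‖ ≤ 1 / 2 := by rwa [norm_cplx]
  have h := norm_R5loc_le_two_mul hJc cube b
  rw [norm_cplx] at h
  exact (Complex.abs_re_le_norm _).trans h

end RealMatrices

/-! ## §7 Non-vacuity -/

section Examples

/-- The hypotheses of (onionstew) are met: `S = 1`, `δ = ½·1` on a two-point lattice (`‖S⁻¹δ‖ = ½ < 1`), and then
`det(S − δ) = det S · e^{R^{(5)}}`. -/
example : ((1 : Matrix (Fin 2) (Fin 2) ℂ) - (1 / 2 : ℂ) • (1 : Matrix (Fin 2) (Fin 2) ℂ)).det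
    = (1 : Matrix (Fin 2) (Fin 2) ℂ).det * Complex.exp (R5 1 ((1 / 2 : ℂ) • (1 : Matrix (Fin 2) (Fin 2) ℂ))) := by
  refine det_loc_eq_det_mul_cexp_R5 (by simp) ?_
  rw [inv_one, Matrix.one_mul, norm_smul, norm_one]
  norm_num

end Examples

end Literature.MathematicalPhysics.QuantumFieldTheory.Dimock2011to13.LocalSquareRootDeterminant

end
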